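import Literature.AlgebraicGeometry.FundamentalGroup.RiemannExistenceCurveCriticalValues
import Literature.AlgebraicGeometry.FundamentalGroup.RiemannExistenceCurveNoether
import Literature.Topology.CoveringSpaces.FiniteCoveringProper
import Literature.Geometry.Kaehler.RiemannSurfaceLocalInverse
import Literature.Geometry.Kaehler.RiemannSurfaceEndsSeparating
import Literature.Analysis.Complex.BranchedCoveringCharPoly
import Literature.AlgebraicGeometry.Motives.VarietiesGeometricallyIntegralProofs
import Literature.NumberTheory.Transcendental.AnalytificationSeparatedProofs
import HarnessLib

/-!
# Riemann's existence theorem for smooth affine curves: the transcendental input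

Layer `Literature/AlgebraicGeometry/FundamentalGroup`. This file assembles the CURVE CASE of the
transcendental half of Riemann's existence theorem (SGA1 XII Thm. 5.1) in the form consumed by
`riemannExistence_qbarDescent_of_finiteIndex_of_integralSeparating`
(`RiemannExistenceQbarDescentProofs`), restricted to relative dimension `1`:

* `integralSeparating_of_smoothOfRelativeDimension_one` — for `S` a smooth irreducible affine curve
  over `ℂ`, every finite-fibred topological covering `q : T → S(ℂ)` and every `P₀ ∈ S(ℂ)` admit a
  continuous `h : T → ℂ` INTEGRAL over `Γ(S, 𝒪_S)` (a monic `R ∈ Γ(S, 𝒪_S)[Y]` with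
  `R^{q t}(h t) = 0` for all `t`) and INJECTIVE on the fibre `q⁻¹{P₀}`.

Proof (Forster, *Lectures on Riemann Surfaces*, §8 and §14 road, made algebraic by a finite
projection): `T` is a Riemann surface (charts `CurveCharts.chartedSpace` pulled back from the
algebraic charts of `S(ℂ)`); a Noether normalisation `f : S → 𝔸¹` (`LineProjection.exists_finite_eval₂RingHom`)
gives a proper holomorphic `F = f ∘ q : T → ℂ` with finite fibres (`LineProjection.isProperMap_eval`,
`IsCoveringMap.isProperMap_of_finite`), a local biholomorphism off the finitely many critical VALUES
of `f` (`CurveCharts.exists_finset_deriv_ne_zero`, `exists_localInverse_of_deriv_ne_zero`); so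
`F` is holomorphic ends data (`EndsDatum.ofLocHomeo`) and `T` embeds in a compact Riemann surface on
which Cartan–Serre finiteness produces a continuous `h` of polynomial growth in `F`, holomorphic off
finitely many points and injective on `F⁻¹{f(P₀)} ⊇ q⁻¹{P₀}`
(`EndsDatum.exists_continuous_injOn_growth`); the characteristic polynomial of `h` along `F` has
POLYNOMIAL coefficients (`BranchedCovering.exists_charPoly`, Riemann extension + Liouville), i.e. `h`
is integral over `ℂ[f] ⊆ Γ(S, 𝒪_S)`.

Everything is proved; there are no definitions. This is the induction base (dimension `1`) of the
smooth affine case of SGA1 XII Thm. 5.1; the general case needs the all-dimensional statement.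

## References

* A. Grothendieck, M. Raynaud, *SGA 1*, Exp. XII Thm. 5.1. [SGA1]
* O. Forster, *Lectures on Riemann Surfaces*, GTM 81, Springer (1981), §8 Thm. 8.3–8.4, §14 Thm. 14.12.
  [Forster1981]
-/

noncomputable section

open scoped Manifold ContDiff Topology Polynomial
open CategoryTheory AlgebraicGeometry Set Filter Function Polynomial
open Literature.AlgebraicGeometry.Motives
open Literature.AlgebraicGeometry.Motives.AlgPoints (evalOrZero evalOrZero_of_mem)
open Literature.Topology.CoveringSpaces
open Literature.Geometry.Kaehler.RiemannSurface
open Literature.Analysis.Complex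

namespace Literature.AlgebraicGeometry.FundamentalGroup

open LineProjection CurveCharts

/-- **Riemann's existence theorem for smooth affine curves, transcendental input** (SGA1 XII 5.1 in
relative dimension `1`, in the form of `riemannExistence_qbarDescent_of_finiteIndex_of_integralSeparating`):
on every finite-fibred covering `T` of `S(ℂ)`, `S` a smooth irreducible affine curve over `ℂ`, there is
a continuous function integral over `Γ(S, 𝒪_S)` separating the fibre over a given point.
[cite: SGA1, Exp. XII Thm. 5.1] [cite: Forster1981, §8 Thm. 8.3 and §14 Thm. 14.12] -/
theorem integralSeparating_of_smoothOfRelativeDimension_one (S : SchemeOver ℂ) [IsAffine S.left]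
    [SmoothOfRelativeDimension 1 S.hom] [IrreducibleSpace S.left] {T : Type*} [TopologicalSpace T]
    {q : T → ComplexPoints S} (hq : IsCoveringMap q) (hqfin : ∀ P, (q ⁻¹' {P}).Finite) (P₀ : ComplexPoints S) :
    ∃ (h : T → ℂ) (R : Polynomial Γ(S.left, ⊤)), Continuous h ∧ R.Monic ∧
      (∀ t, (R.map ((q t).evalRingHom ⊤ trivial)).eval (h t) = 0) ∧ InjOn h (q ⁻¹' {P₀}) := by
  classical
  -- instances on `S`
  haveI : Smooth S.hom := SmoothOfRelativeDimension.smooth 1 S.hom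
  haveI : LocallyOfFiniteType S.hom := inferInstance
  haveI : IsReduced S.left := isReduced_of_smooth_over_field S.hom
  haveI : IsIntegral S.left := isIntegral_of_irreducibleSpace_of_isReduced S.left
  -- the empty covering
  rcases isEmpty_or_nonempty T with hT | hT
  · exact ⟨fun _ ↦ 0, X, continuous_const, monic_X, fun t ↦ isEmptyElim t, fun t ↦ isEmptyElim t⟩
  -- `T` is a Hausdorff Riemann surface without isolated points
  haveI : T2Space (ComplexPoints S) := ComplexPoints.t2Space_of_isSeparated S
  haveI : T2Space T := by
    refine ⟨fun t₁ t₂ hne ↦ ?_⟩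
    by_cases hqt : q t₁ = q t₂
    · exact hq.isSeparatedMap t₁ t₂ hqt hne
    · obtain ⟨u, v, hu, hv, h₁, h₂, huv⟩ := t2_separation hqt
      exact ⟨q ⁻¹' u, q ⁻¹' v, hu.preimage hq.continuous, hv.preimage hq.continuous, h₁, h₂, huv.preimage q⟩
  have hql : IsLocalHomeomorph q := hq.isLocalHomeomorph
  letI : ChartedSpace ℂ T := CurveCharts.chartedSpace S hql
  haveI : IsManifold 𝓘(ℂ, ℂ) ω T := CurveCharts.isManifold (S := S) hql
  haveI : ∀ t : T, (𝓝[≠] t).NeBot := fun t ↦ CurveCharts.neBot_nhdsNE t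
  -- Step 1: a finite projection to the line
  obtain ⟨f, hfin⟩ := exists_finite_eval₂RingHom S
  set F₀ : ComplexPoints S → ℂ := fun P ↦ P.eval ⊤ trivial f with hF₀
  set F : T → ℂ := fun t ↦ (q t).eval ⊤ trivial f with hF
  have hFc : Continuous F := (continuous_eval S f).comp hq.continuous
  have hqprop : IsProperMap q := IsCoveringMap.isProperMap_of_finite hq hqfin
  have hFp : IsProperMap F := (isProperMap_eval S f hfin).comp hqprop
  have hFfin : ∀ z, (F ⁻¹' {z}).Finite := fun z ↦
    (finite_preimage_eval S f hfin z).preimage' fun P _ ↦ hqfin P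
  have hF_md : MDifferentiable 𝓘(ℂ, ℂ) 𝓘(ℂ, ℂ) F := by
    intro t
    have h := mdifferentiableAt_evalOrZero_comp hql ⟨⊤, isAffineOpen_top S.left⟩ f (t := t) trivial
    refine h.congr_of_eventuallyEq (Eventually.of_forall fun s ↦ ?_)
    exact (evalOrZero_of_mem f (trivial : (q s).pt ∈ (⊤ : S.left.Opens))).symm
  -- Step 2: critical values and holomorphic local inverses of `F` off them
  have hint : (eval₂RingHom (structureMap S) f).IsIntegral := RingHom.IsIntegral.of_finite hfin
  obtain ⟨Δ, hΔ⟩ := exists_finset_deriv_ne_zero S f hint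
  have L1 : ∀ t, F t ∉ Δ → ∃ e : OpenPartialHomeomorph T ℂ, t ∈ e.source ∧ ⇑e = F ∧
      MDifferentiableOn 𝓘(ℂ, ℂ) 𝓘(ℂ, ℂ) e.symm e.target := by
    intro t ht
    have hderiv := hΔ (q t) ht
    have hc : chartAt ℂ t = curveChart S hql t := rfl
    have htgt : chartAt ℂ t t ∈ (chartAt ℂ t).target := (chartAt ℂ t).map_source (mem_chart_source ℂ t)
    refine exists_localInverse_of_deriv_ne_zero (U₀ := (chartAt ℂ t).target) (chartAt ℂ t).open_target htgt
      subset_rfl ?_ ?_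
    · have hG := (contDiffOn_eval_algChart_symm S (q t) f).differentiableOn (by simp)
      refine (hG.mono (by rw [hc]; exact curveChart_target_subset hql t)).congr fun z hz ↦ ?_
      rw [hc] at hz
      show (q ((curveChart S hql t).symm z)).eval ⊤ trivial f = _
      rw [q_curveChart_symm hql hz]
    · have heq : (F ∘ (chartAt ℂ t).symm) =ᶠ[𝓝 (chartAt ℂ t t)]
          fun z ↦ ((algChart S (q t)).symm z).eval ⊤ trivial f := by
        filter_upwards [(chartAt ℂ t).open_target.mem_nhds htgt] with z hz
        rw [hc] at hz
        show (q ((curveChart S hql t).symm z)).eval ⊤ trivial f = _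
        rw [q_curveChart_symm hql hz]
      rw [heq.deriv_eq, hc, curveChart_apply]
      exact hderiv
  -- Step 3: `F` is holomorphic ends data on `T`
  set R : ℝ := 1 + ∑ c ∈ Δ, ‖c‖ with hRdef
  have hR : 0 < R := by
    have h0 : 0 ≤ ∑ c ∈ Δ, ‖c‖ := Finset.sum_nonneg fun c _ ↦ norm_nonneg c
    linarith
  have hnotΔ : ∀ t, F t ∈ extDisc R → F t ∉ Δ := by
    intro t ht hmem
    have h1 : ‖F t‖ ≤ ∑ c ∈ Δ, ‖c‖ := Finset.single_le_sum (fun c _ ↦ norm_nonneg c) hmem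
    rw [mem_extDisc] at ht
    linarith
  have hloc : IsLocalHomeomorphOn F (F ⁻¹' extDisc R) := by
    intro t ht
    obtain ⟨e, hte, heF, -⟩ := L1 t (hnotΔ t ht)
    exact ⟨e, hte, heF.symm⟩
  set D : EndsDatum T := EndsDatum.ofLocHomeo F R hR hFc hFp hFfin hloc with hDdef
  have hD : D.IsHolomorphic := ⟨hF_md, fun t ht ↦ L1 t (hnotΔ t ht)⟩
  -- Step 4: a continuous function of polynomial growth separating the fibre `F⁻¹{f(P₀)}`
  obtain ⟨h, P, C₀, K, hhc, hhmd, hinj, hgrowth⟩ := D.exists_continuous_injOn_growth hD (F₀ P₀)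
  -- Step 5: its characteristic polynomial along `F` has polynomial coefficients
  set Δ₆ : Set ℂ := ↑Δ ∪ F '' ↑P with hΔ₆def
  have hΔ₆ : Δ₆.Finite := Δ.finite_toSet.union (P.finite_toSet.image F)
  have hloc₆ : ∀ t, F t ∉ Δ₆ → ∃ e : OpenPartialHomeomorph T ℂ,
      t ∈ e.source ∧ ⇑e = F ∧ DifferentiableOn ℂ (h ∘ e.symm) e.target := by
    intro t ht
    have htΔ : F t ∉ Δ := fun hm ↦ ht (Or.inl hm)
    have htP : t ∉ P := fun hp ↦ ht (Or.inr ⟨t, hp, rfl⟩)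
    obtain ⟨e₀, hte₀, he₀F, he₀symm⟩ := L1 t htΔ
    have hPc : IsClosed (↑P : Set T) := P.finite_toSet.isClosed
    refine ⟨e₀.restrOpen (↑P)ᶜ hPc.isOpen_compl, ⟨hte₀, fun hp ↦ htP (Finset.mem_coe.1 hp)⟩, he₀F, ?_⟩
    intro w hw
    have hw₀ : w ∈ e₀.target := hw.1
    have hwP : e₀.symm w ∉ P := fun hp ↦ hw.2 (Finset.mem_coe.2 hp)
    have h1 : MDifferentiableAt 𝓘(ℂ, ℂ) 𝓘(ℂ, ℂ) e₀.symm w :=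
      (he₀symm w hw₀).mdifferentiableAt (e₀.open_target.mem_nhds hw₀)
    have h2 : MDifferentiableAt 𝓘(ℂ, ℂ) 𝓘(ℂ, ℂ) (h ∘ e₀.symm) w := (hhmd _ hwP).comp w h1
    exact (mdifferentiableAt_iff_differentiableAt.1 h2).differentiableWithinAt
  obtain ⟨R₀, hR₀monic, hR₀root⟩ :=
    BranchedCovering.exists_charPoly hFp hFfin hΔ₆ hhc hloc₆ hgrowth
  -- Step 6: transfer to `Γ(S, 𝒪_S)` along `ℂ[t] → Γ(S, 𝒪_S)`, `t ↦ f`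
  refine ⟨h, R₀.map (eval₂RingHom (structureMap S) f), hhc, hR₀monic.map _, fun t ↦ ?_, ?_⟩
  · rw [Polynomial.map_map, evalRingHom_comp_eval₂RingHom]
    exact hR₀root t
  · intro t₁ ht₁ t₂ ht₂ heq
    have h₁ : q t₁ = P₀ := ht₁
    have h₂ : q t₂ = P₀ := ht₂
    refine hinj ?_ ?_ heq
    · show (q t₁).eval ⊤ trivial f = P₀.eval ⊤ trivial f
      rw [h₁]
    · show (q t₂).eval ⊤ trivial f = P₀.eval ⊤ trivial f
      rw [h₂]

end Literature.AlgebraicGeometry.FundamentalGroup
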